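import Summits.CriticalPhenomena.PercolationContinuityZ3.Theorems.PercNearOneGluingNoHeavyLowerTailSunflowerThreeBlockCombIntervalChunksA
import Summits.CriticalPhenomena.PercolationContinuityZ3.Theorems.PercNearOneGluingNoHeavyLowerTailSunflowerThreeBlockCombIntervalChunksB
import Summits.CriticalPhenomena.PercolationContinuityZ3.Theorems.PercNearOneGluingNoHeavyLowerTailSunflowerThreeBlockCombIntervalChunksC
import Summits.CriticalPhenomena.PercolationContinuityZ3.Theorems.PercNearOneGluingNoHeavyLowerTailSunflowerThreeBlockCardSymmetric
import HarnessLib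
import HarnessLib.Audit

/-!
# `NoHeavyLowerTail` (crux stmt-CriticalPhenomena-4575), abstract sunflower cubic: the THREE-BLOCK theorem with STANDARD AXIOMS — assembly of the kernel-checked
# branch and bound

Support file (seat `prim-ineq-gen-2` gen 21; `--supports stmt-CriticalPhenomena-4575`).  No `sorry`, no named facts, no compiled evaluation: the axioms of every theorem
below are `propext`, `Classical.choice`, `Quot.sound` (the top search `dfsTop_frontier` and the 48 chunks are `decide +kernel` at default heartbeats).  This upgrades
the three-block theorem of `…SunflowerThreeBlockComb` (p279797, one `native_decide`) to a kernel-checked theorem; statements are given in combined form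
(all three kernels / all three rows at once).  Memo: run/shared/lean/prim/prim-ineq-gen-2/THREEBLOCK-LEAN-GEN21.md §8.

* `dfsTop_frontier` — the top search over the `48`-prefix frontier succeeds; with `chunksA/B/C`: `comb_height_two_kernel`.
* **`comb_chain_three_blocks`** — COMB_chain (`0 ≤ ZFC κ G c`, all classes) for every three-block quotient of every height and `κ ∈ {s6H, s6G, s6T}`.
* **`partitionLemma_composeC_three_blocks`** — `0 ≤ ZH ∧ 0 ≤ ZG ∧ 0 ≤ ZT` for every chain composition on three blocks (every height, every gadget family).
* **`partitionLemma_of_isCardDetermined`** — the same for every cardinality-determined sunflower on a three-block ground set (direct form, via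
  `composeC_quotOf_V` of `…SunflowerThreeBlockCardSymmetric`).
-/

namespace Summit.CriticalPhenomena.PercolationContinuityZ3.Theorems.SunflowerPartition

open Finset

namespace ThreeBlockComb

open ChainComb

/-- The chunk frontier: `48` prefixes whose subtrees are checked in `…IntervalChunksA/B/C`. [this work] -/
def frontier : List (List (Fin 5)) := frontA ++ frontB ++ frontC

/-- Every chunk of the frontier succeeds. [this work] -/
theorem chunks_frontier : ∀ pre ∈ frontier, dfsFromK pre = true := by
  intro pre hpre
  simp only [frontier, List.mem_append] at hpre
  rcases hpre with (h | h) | h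
  · exact chunksA pre h
  · exact chunksB pre h
  · exact chunksC pre h

/-- **The top search succeeds** (kernel evaluation of the `≈ 150`-node tree above the frontier). [this work] -/
theorem dfsTop_frontier : dfsTop frontier 27 0 initK false false [] = true := by
  decide +kernel

/-- **COMB_chain for every height-two three-block quotient, kernels `s6H, s6G, s6T` — standard axioms.** [this work] -/
theorem comb_height_two_kernel (G : Sunflower (Σ b : Fin 3, Fin (two (Fin 3) b))) (κ : Fin 5 → Fin 5 → Fin 5 → ℤ)
    (hκ : κ = s6H ∨ κ = s6G ∨ κ = s6T) (c : ∀ b : Fin 3, Fin 3 → Fin (two (Fin 3) b + 1)) : 0 ≤ ZFC κ G c := by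
  have h := comb_height_two_of_dfsTop frontier chunks_frontier dfsTop_frontier G c
  rcases hκ with rfl | rfl | rfl
  · exact h.1
  · exact h.2.1
  · exact h.2.2

variable {r : Fin 3 → ℕ} {β : Fin 3 → Type*} [∀ b, Fintype (β b)] [∀ b, DecidableEq (β b)]

/-- **COMB_chain for EVERY three-block quotient of every height**, kernels `s6H, s6G, s6T` (standard axioms). [this work] -/
theorem comb_chain_three_blocks (G : Sunflower (Σ b, Fin (r b))) (κ : Fin 5 → Fin 5 → Fin 5 → ℤ) (hκ : κ = s6H ∨ κ = s6G ∨ κ = s6T) :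
    ∀ c : (∀ b, Fin 3 → Fin (r b + 1)), 0 ≤ ZFC κ G c :=
  comb_chain_of_height_two κ (fun G' c' => comb_height_two_kernel G' κ hκ c') G

/-- **THE THREE-BLOCK PARTITION LEMMA (rows H, G, T), standard axioms**: `0 ≤ ZH`, `0 ≤ ZG`, `0 ≤ ZT` for every sunflower reading three disjoint finite blocks
through arbitrary monotone chain statistics of arbitrary heights. [this work] -/
theorem partitionLemma_composeC_three_blocks (G : Sunflower (Σ b, Fin (r b))) (h : CGadget β r) :
    0 ≤ (G.composeC h).ZH ∧ 0 ≤ (G.composeC h).ZG ∧ 0 ≤ (G.composeC h).ZT := by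
  refine ⟨?_, ?_, ?_⟩
  · rw [Sunflower.ZH_eq_Zp]
    exact Zp_composeC_nonneg_of_height_two s6H (fun G' c' => comb_height_two_kernel G' s6H (Or.inl rfl) c') G h
  · rw [Sunflower.ZG_eq_Zp]
    exact Zp_composeC_nonneg_of_height_two s6G (fun G' c' => comb_height_two_kernel G' s6G (Or.inr (Or.inl rfl)) c') G h
  · rw [Sunflower.ZT_eq_Zp]
    exact Zp_composeC_nonneg_of_height_two s6T (fun G' c' => comb_height_two_kernel G' s6T (Or.inr (Or.inr rfl)) c') G h

/-- **The three-block partition lemma in direct form, standard axioms**: every CARDINALITY-DETERMINED sunflower on a three-block ground set satisfies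
`0 ≤ ZH ∧ 0 ≤ ZG ∧ 0 ≤ ZT`. [this work] -/
theorem partitionLemma_of_isCardDetermined {F : Sunflower (Σ b, β b)} (hF : IsCardDetermined F) : 0 ≤ F.ZH ∧ 0 ≤ F.ZG ∧ 0 ≤ F.ZT := by
  obtain ⟨hH, hG, hT⟩ := partitionLemma_composeC_three_blocks (quotOf F) (cardGadget β)
  refine ⟨?_, ?_, ?_⟩
  · rw [← Sunflower.ZH_congr (F := (quotOf F).composeC (cardGadget β)) (fun k => composeC_quotOf_V hF k)]
    exact hH
  · rw [Sunflower.ZG_eq_Zp, ← Zp_congr_of_V (F := (quotOf F).composeC (cardGadget β)) (fun k => composeC_quotOf_V hF k), ← Sunflower.ZG_eq_Zp]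
    exact hG
  · rw [Sunflower.ZT_eq_Zp, ← Zp_congr_of_V (F := (quotOf F).composeC (cardGadget β)) (fun k => composeC_quotOf_V hF k), ← Sunflower.ZT_eq_Zp]
    exact hT

end ThreeBlockComb

end Summit.CriticalPhenomena.PercolationContinuityZ3.Theorems.SunflowerPartition
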